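import Literature.NumberTheory.EllipticCurves.CastellaGrossiLeeSkinner2022.AnticyclotomicControl
import Summits.BirchSwinnertonDyer.Rank1Residual.Partition.TamagawaHeegnerAnyPrime
import Summits.BirchSwinnertonDyer.Rank1Residual.X11b.LocalTorsionMultiplicative
import Literature.NumberTheory.EllipticCurves.AnomalousOfRationalTorsionProofs
import Literature.NumberTheory.EllipticCurves.LeadingTermTamagawaProofs
import Literature.NumberTheory.EllipticCurves.BSDSelmerSkinnerThmBProofs
import Literature.NumberTheory.EllipticCurves.SupersingularIrreducibleProofs
import HarnessLib

/-!
# (CTL)ᵍ FED BY A PUBLISHED FACT: the anticyclotomic control link `X11b.ControlOnTreeGoodAt` at a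
# non-anomalous good ordinary prime is Castella–Grossi–Lee–Skinner 2022 Thm. 5.1.1, now a Literature
# named fact on the Literature twin of the cell's constructed `X_ac` (cell `b2b-bsdres`, lit-cgls s5)

HONEST FRAMING (cell `b2b-bsdres`, run/shared/lean/b2b/bsd-rank1-residual/, verbatim in every
file): the goal of the cell is to DELETE the COMBINATION-SHAPED residual classes of the
Birch–Swinnerton-Dyer formula for ALL analytic-rank `≤ 1` elliptic curves over `ℚ` — "full BSD
formula for every rank `≤ 1` curve in class `C`" assembled STRICTLY from published theorems — so
that the rank-`≤ 1` remainder becomes exactly the CONSTRUCTION-SHAPED classes, which are TYPED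
(missing-input `Prop`s), NOT attempted. This is not "finishing BSD". Unit `b2b-bsdres-lit-cgls`
(off-peak literature typer, source = Castella–Grossi–Lee–Skinner 2022 / Greenberg–Vatsal 2000),
session 5. THEOREMS ONLY (no definition, no named fact, no `sorry`); nothing booked; no label moved.

## What and why

Sized ask S1a of the seat (= A1′ of the GLUE seat, `HOME/b2b-bsdres-lit-glue/GLUE.md` §G3.4): the
covered rank-one rows C2 / C3-ord / C6 / C16 of the PARTITION table stand one level below STEP L on two
typed links per datum, `X11b.IMCLowerWaldspurgerOnTreeGoodAt` ((IMC≥)∘BDP) and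
`X11b.ControlOnTreeGoodAt` ((CTL)ᵍ), predicates ON THE CONSTRUCTED `Λ`-module `X_ac` that could not be
named facts because `X_ac` lived under `Summits/`. This session re-homed the construction to
Literature (`Castella2018/AnticyclotomicSelmer{,Dual}.lean`, `PadicFormalLogOrder.lean`: SAME names
and bodies, so the Summits objects are definitionally equal to the Literature ones — §0 below checks
this in the kernel by `Iff.rfl` / `rfl`) and vendored CGLS 2022 Thm. 5.1.1 on it
(`CastellaGrossiLeeSkinner2022.thm511_anticyclotomicControl`). Consequences proved here:

* §0 `AcSelmer.hasCharValuationAt_iff_literature`, `padicLogOrd_eq_literature` — the DEFEQ BRIDGE: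
  the cell's `X11b.AcSelmer.XAc.HasCharValuationAt` / `X11b.padicLogOrd` ARE the Literature ones.
* §1 `LocalTorsion.localTorsion_eq_zero_of_good_of_not_dvd` — `E(ℚ_p)[p] = 0` at a good `p ≥ 3` with
  `a_p ≢ 1 (mod p)` (Silverman VII.2.1/VII.3.1: `[E(ℚ_p):E₁(ℚ_p)] = #Ẽ(𝔽_p) = p + 1 − a_p`,
  `E₁(ℚ_p)[p] = 0`) — the first hypothesis of Thm. 5.1.1 in the cell's predicate currency (`¬ Anom`);
  the good-`p` twin of multr1's `localTorsion_eq_zero_of_mult`.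
* §2 `controlOnTreeGoodAt_of_thm511` — CGLS Thm. 5.1.1 ⟹ `ControlOnTreeGoodAt p κ v̄ γ ι P` at every
  datum of the theorem (all `ℓ ∣ N` split: `∏_{w∣N} c_w(E/K)` vs `∏_{w∣N⁺} c_w`, equal by
  `padicValNat_tamagawa_of_heegner_anyPrime`); `controlOnTreeGoodAt_of_thm511_of_not_dvd` (with §1).
* §3 `indexLowerBoundAt_of_heegner_of_thm511` — STEP L `X11b.IndexLowerBoundAt W p K P_K` at a
  classical Heegner datum, `ord_{s=1}L(E,s) = 1`, good ordinary non-anomalous `p > 2` split in `K`,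
  from (IMC≥∘BDP)ᵍ (STILL TYPED, `hIW`) + the PUBLISHED (CTL)ᵍ (`h511`) + GZ + Kolyvagin + GZK +
  modularity — i.e. lit-glue's `indexLowerBoundAt_of_heegner_of_onTreeGoodLowerLinks_anyPrime` with
  its binder `hCTL` DISCHARGED by a named fact (the hypotheses `rank_ℤ E(K) = 1`, `#Ш(E/K)[p^∞] < ∞`,
  `P_K` of infinite order of Thm. 5.1.1 are themselves discharged: `mordellWeilRank_baseChange_eq_one_
  and_finite_sha_of_twist_L_one_ne_zero`, `not_isOfFinAddOrder_of_heegner_of_analyticRank_eq_one`).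
  Holds for `E[p]` IRREDUCIBLE OR REDUCIBLE: CGLS 5.1.1 assumes only `E(ℚ_p)[p] = 0`, so on the
  non-anomalous locus it serves rows C2 / C3-ord / C16 as well as the Eisenstein row C6; at an
  ANOMALOUS irreducible `p` the control theorem in print is JSW17 Thm. 3.3.1 (to be typed on the same
  object by the JSW/Castella typers — pointer in GLUE.md).

Nothing here changes a label: STEP L's other antecedent (IMC≥∘BDP)ᵍ stays typed (for C6 the published
equality is CGLS Thm. 4.2.2, whose `𝓛_E ∈ Λ^ur` has no Literature object yet — S1b).

References: [CastellaGrossiLeeSkinner2022] Thm. 5.1.1 (arXiv:2008.02571v2 TeX L2403–L2429);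
[Castella2018] Def. 2.2, Thm. 2.3; [JetchevSkinnerWan2017] Thm. 3.3.1, §7.3.1 (eq:tamK), §7.4.1;
[SilvermanAEC2009] VII.2.1, VII.3.1; HOME/b2b-bsdres-lit-cgls/CGLS-GV-TYPING.md §12;
HOME/b2b-bsdres-lit-glue/GLUE.md §G3.4 (A1′).
-/

noncomputable section

open scoped Classical

open WeierstrassCurve NumberField IsDedekindDomain Literature.NumberTheory.EllipticCurves
  Literature.NumberTheory.EllipticCurves.ModularForms
  Literature.NumberTheory.EllipticCurves.Rank1Residual
  Literature.NumberTheory.EllipticCurves.CastellaGrossiLeeSkinner2022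
  Summit.BirchSwinnertonDyer.BirchSwinnertonDyer.Rank1Residual.IntModel
  Summit.BirchSwinnertonDyer.BirchSwinnertonDyer.Theorems

namespace Summit.BirchSwinnertonDyer.Rank1Residual.X11b

/-! ### §0 The defeq bridge: the cell's constructed objects ARE the Literature objects -/

section Bridge

variable {K : Type} [Field K] [NumberField K]

/-- **The Summits `X_ac`-shape IS the Literature one.** `X11b.AcSelmer.XAc.HasCharValuationAt` (multr1,
p215153) and `Literature.…Castella2018.AcSelmer.XAc.HasCharValuationAt` (this seat, the re-homed
construction) unfold to the same term: the equivalence is `Iff.rfl`, checked by the kernel. Hence every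
Literature named fact stated on the Literature `X_ac` feeds the cell's Summits-side predicates.
[cite: Castella2018, Def. 2.2 and Thm. 2.3 (arXiv:1704.06608 p. 5)] -/
theorem AcSelmer.hasCharValuationAt_iff_literature (W' : WeierstrassCurve K) (p : ℕ) [Fact p.Prime]
    (κ : ZpExtension K p) (𝔭 : HeightOneSpectrum (𝓞 K)) (S : Set (HeightOneSpectrum (𝓞 K)))
    (γ : Field.absoluteGaloisGroup K) [Fact (κ.IsTopGenerator γ)] (n : ℕ) :
    AcSelmer.XAc.HasCharValuationAt W' p κ 𝔭 S γ n ↔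
      Literature.NumberTheory.EllipticCurves.Castella2018.AcSelmer.XAc.HasCharValuationAt
        W' p κ 𝔭 S γ n :=
  Iff.rfl

/-- **The Summits `ord_p log_{ω_E} P` IS the Literature one** (`X11b.padicLogOrd`, multr1, vs
`Literature.NumberTheory.EllipticCurves.padicLogOrd`, re-homed): `rfl`.
[cite: CastellaGrossiLeeSkinner2022, Thm. 5.1.1 (the symbol `log_{ω_E} P`)] -/
theorem padicLogOrd_eq_literature (W : WeierstrassCurve ℚ) [W.IsElliptic] [W.IsGloballyMinimal]
    (p : ℕ) [Fact p.Prime] (ι : K →+* ℚ_[p]) (P : (W.baseChange K).toAffine.Point) :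
    padicLogOrd W p ι P = Literature.NumberTheory.EllipticCurves.padicLogOrd W p ι P :=
  rfl

end Bridge

/-! ### §1 `E(ℚ_p)[p] = 0` at a good prime `p ≥ 3` with `a_p ≢ 1 (mod p)` -/

section LocalTorsion

variable (W : WeierstrassCurve ℚ) [W.IsElliptic] [W.IsGloballyMinimal] (p : ℕ) [hp : Fact p.Prime]

/-- **`E(ℚ_p)[p] = 0` at a good `p ≥ 3` with `a_p ≢ 1 (mod p)`** — the first hypothesis of CGLS
Thm. 5.1.1 in the cell's currency. For `W/ℚ` globally minimal elliptic, `p ≥ 3` of good reduction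
with `p ∤ a_p − 1`: every `ℚ_p`-point `P` with `p • P = O` is `O`. Proof (the good-`p` twin of multr1's
`localTorsion_eq_zero_of_mult`): `m • P ∈ E₁(ℚ_p)` for `m = [E(ℚ_p) : E₁(ℚ_p)] = c_p · #Ẽ(𝔽_p)`
(`index_formalFiltration`) with `c_p = 1` (`localTamagawaNumber_padic_eq_one_of_good_holds`) and
`#Ẽ(𝔽_p) = N_p = p + 1 − a_p` (`natCard_point_reduction_baseChange_padic`), `E₁(ℚ_p)[p] = 0` for
`p ≥ 3` (`stubC_eq_zero_of_isInReductionKernel`), so `m • P = O`; `p ∣ N_p ⟺ p ∣ a_p − 1`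
(`dvd_reductionPointCount_iff_dvd_frobeniusTrace_sub_one`), so `p ∤ m` and `P = O`.
[cite: SilvermanAEC2009, VII.2 Prop. 2.1, VII.3 Prop. 3.1] [cite: CastellaGrossiLeeSkinner2022, Thm. 5.1.1 (hypothesis `E(ℚ_p)[p] = 0`)] -/
theorem LocalTorsion.localTorsion_eq_zero_of_good_of_not_dvd (hp3 : 3 ≤ p) (hgood : Good W p)
    (hna : ¬ (p : ℤ) ∣ W.frobeniusTrace p - 1)
    (P : (W.baseChange ℚ_[p]).toAffine.Point) (hP : p • P = 0) : P = 0 := by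
  have hp' : p.Prime := hp.out
  haveI : (W.baseChange ℚ_[p]).IsMinimal ℤ_[p] := isMinimal_map_padic_of_isGloballyMinimal W p
  haveI : (W.baseChange ℚ_[p]).IsElliptic := by rw [baseChange]; infer_instance
  set m : ℕ := ((W.baseChange ℚ_[p]).formalFiltration 1).index with hm
  -- `m = c_p · N_p = N_p`, prime to `p`
  have hidx : m = (W.baseChange ℚ_[p]).localTamagawaNumber ℤ_[p] * reductionPointCount W p := by
    rw [hm, index_formalFiltration (W.baseChange ℚ_[p]) (le_refl 1), pow_zero, mul_one,
      LocalTorsion.natCard_point_reduction_baseChange_padic]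
  have hc : (W.baseChange ℚ_[p]).localTamagawaNumber ℤ_[p] = 1 :=
    localTamagawaNumber_padic_eq_one_of_good_holds W p hgood
  have hcop : ¬ p ∣ m := by
    rw [hidx, hc, one_mul]
    intro hd
    exact hna ((dvd_reductionPointCount_iff_dvd_frobeniusTrace_sub_one W p).mp hd)
  -- `m • P ∈ E₁(ℚ_p)` and `p` kills it
  have hmem : m • P ∈ (W.baseChange ℚ_[p]).formalFiltration 1 :=
    AddSubgroup.nsmul_index_mem _ P
  have hker : (W.baseChange ℚ_[p]).IsInReductionKernel (m • P) := hmem.1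
  have hkill : (p : ℤ) • (m • P) = 0 := by
    rw [natCast_zsmul, smul_comm, hP, nsmul_zero]
  have hzero : m • P = 0 :=
    stubC_eq_zero_of_isInReductionKernel hp3 ((integralModelInt W).map (Int.castRingHom ℤ_[p]))
      (W.baseChange ℚ_[p]) (padicModel_baseChange W p) _ hker hkill
  exact stubC_eq_zero_of_zsmul_of_nsmul hp' hcop P (by rw [natCast_zsmul]; exact hP) hzero

/-- The same at a NON-ANOMALOUS good Eisenstein prime in the cell's predicate currency (`Good`, `Red`,
`¬ Anom`: `Anom W p := Red ∧ Good ∧ p ∣ a_p − 1`). [cite: CastellaGrossiSkinner2025, Thm. D (hypothesis `φ|_{G_p} ≠ 1, ω`)] -/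
theorem LocalTorsion.localTorsion_eq_zero_of_good_of_not_anom (hp3 : 3 ≤ p) (hgood : Good W p)
    (hred : Red W p) (hna : ¬ Anom W p) :
    ∀ P : (W.baseChange ℚ_[p]).toAffine.Point, p • P = 0 → P = 0 :=
  LocalTorsion.localTorsion_eq_zero_of_good_of_not_dvd W p hp3 hgood (fun h ↦ hna ⟨hred, hgood, h⟩)

omit [W.IsElliptic] [W.IsGloballyMinimal] in
/-- **`E(K)[p] = 0` from `E(ℚ_p)[p] = 0` along an embedding `K ↪ ℚ_p`** (CGLS 2022, proof of
Thm. 5.1.1: "`E(K)[p] = 0` … is implied by the hypothesis `E(ℚ_p)[p] = 0` since `p` splits in `K`";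
§3.2 hypothesis (h1) of the setting of Thm. 4.2.2): the map `E(K) → E(ℚ_p)` induced by a field
embedding is an injective group homomorphism (Mathlib `Point.map_injective`). For ANY field `K` with a
ring map to `ℚ_p`. [cite: CastellaGrossiLeeSkinner2022, proof of Thm. 5.1.1 (arXiv v2 TeX L2426–L2429) and §3.2 (h1) (L1255–L1257)] -/
theorem LocalTorsion.torsion_baseChange_eq_zero_of_embedding {K : Type} [Field K] [CharZero K]
    (ι : K →+* ℚ_[p]) (hEp : ∀ Q : (W.baseChange ℚ_[p]).toAffine.Point, p • Q = 0 → Q = 0)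
    (Q : (W.baseChange K).toAffine.Point) (hQ : p • Q = 0) : Q = 0 := by
  have h0 : WeierstrassCurve.Affine.Point.map ι.toRatAlgHom Q = 0 :=
    hEp _ (by rw [← map_nsmul, hQ, map_zero])
  exact WeierstrassCurve.Affine.Point.map_injective ι.toRatAlgHom (by rw [h0, map_zero])

/-- **(h1) `E(K)[p] = 0` at a NON-ANOMALOUS good `p ≥ 3` for every field `K` that embeds in `ℚ_p`**
(e.g. an imaginary quadratic `K` with `p` split: `K ↪ K_v = ℚ_p`) — CGLS 2022, proof of Thm. 5.3.1:
"The hypotheses on `φ` imply that `E(K)[p] = 0`" (`φ|_{G_p} ≠ 𝟙, ω` with (spl)); v1 of the paper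
stated Thm. 5.1.1 with this hypothesis, v2 = final with `E(ℚ_p)[p] = 0` (§1 above): on the cell's
locus BOTH hold. [cite: CastellaGrossiLeeSkinner2022, proof of Thm. 5.3.1 (arXiv v2 TeX L2630) and proof of Thm. 5.1.1 (L2426–L2429)]
[cite: SilvermanAEC2009, VII.3 Prop. 3.1] -/
theorem LocalTorsion.torsion_baseChange_eq_zero_of_good_of_not_anom {K : Type} [Field K]
    [CharZero K] (ι : K →+* ℚ_[p]) (hp3 : 3 ≤ p) (hgood : Good W p) (hred : Red W p)
    (hna : ¬ Anom W p) : ∀ Q : (W.baseChange K).toAffine.Point, p • Q = 0 → Q = 0 :=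
  LocalTorsion.torsion_baseChange_eq_zero_of_embedding W p ι
    (LocalTorsion.localTorsion_eq_zero_of_good_of_not_anom W p hp3 hgood hred hna)

end LocalTorsion

/-! ### §2 (CTL)ᵍ at a datum from the published theorem -/

section Control

variable {W : WeierstrassCurve ℚ} [W.IsElliptic] [W.IsGloballyMinimal] {p : ℕ} [Fact p.Prime]
  {K : Type} [Field K] [NumberField K]

/-- **`X11b.ControlOnTreeGoodAt` FROM CGLS 2022 Thm. 5.1.1.** At every datum of the theorem — `W/ℚ`
globally minimal, `p > 2` good ordinary, `K` imaginary quadratic with `p` split and every `ℓ ∣ N`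
split, `ι : K ↪ ℚ_p` inducing `v`, `v̄ ∋ p` the other prime (the STRICT one), `κ` anticyclotomic with
generator `γ`, `E(ℚ_p)[p] = 0`, `rank_ℤ E(K) = 1`, `#Ш(E/K)[p^∞] < ∞`, `P` of infinite order — the
cell's typed link `ControlOnTreeGoodAt p κ v̄ γ ι P` HOLDS, fed by the named fact through the defeq
bridge (§0) and the all-split Tamagawa identity `ord_p ∏_{w∣N⁺} c_w = ord_p ∏_w c_w(E/K)`
(`padicValNat_tamagawa_of_heegner_anyPrime`). Irreducible or reducible `E[p]` alike.
[cite: CastellaGrossiLeeSkinner2022, Thm. 5.1.1] [cite: Castella2018, Thm. 2.3 (arXiv:1704.06608 p. 5)]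
[cite: JetchevSkinnerWan2017, §7.3.1 (eq:tamK)] -/
theorem controlOnTreeGoodAt_of_thm511 (h511 : thm511_anticyclotomicControl) (hp : 2 < p)
    (hord : GoodOrd W p) (hK : IsImaginaryQuadratic K) (hHp : SatisfiesHeegnerHypothesis p K)
    {N : ℕ} (hN : W.conductorNorm ℤ = N) (hHN : SatisfiesHeegnerHypothesis N K)
    (ι : K →+* ℚ_[p]) (v vbar : HeightOneSpectrum (𝓞 K))
    (hv : ∀ x : 𝓞 K, x ∈ v.asIdeal ↔ ‖ι (x : K)‖ < 1)
    (hvbar : ((p : ℕ) : 𝓞 K) ∈ vbar.asIdeal) (hne : vbar ≠ v)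
    (κ : ZpExtension K p) (hκ : κ.IsAnticyclotomic)
    (γ : Field.absoluteGaloisGroup K) [Fact (κ.IsTopGenerator γ)]
    (hEp : ∀ Q : (W.baseChange ℚ_[p]).toAffine.Point, p • Q = 0 → Q = 0)
    (hrk : (W.baseChange K).mordellWeilRank = 1)
    (hfin : Finite (AddCommGroup.primaryComponent (W.baseChange K).sha p))
    (P : (W.baseChange K).toAffine.Point) (hP : ¬ IsOfFinAddOrder P) :
    ControlOnTreeGoodAt p κ vbar γ ι P := by
  have hHN' : SatisfiesHeegnerHypothesis (W.conductorNorm ℤ) K := by rw [hN]; exact hHN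
  obtain ⟨n, hn, hval⟩ := hasCharValuationAt_of_thm511 h511 hp hord K hK hHp hHN' ι v vbar hv hvbar
    hne κ hκ γ hEp hrk hfin P hP
  obtain ⟨h1, -⟩ := padicValNat_tamagawa_of_heegner_anyPrime (W := W) p hK hN hHN
  refine ⟨n, (AcSelmer.hasCharValuationAt_iff_literature _ p κ vbar ∅ γ n).mpr hn, ?_⟩
  rw [h1, padicLogOrd_eq_literature]
  omega

/-- **(CTL)ᵍ at a non-anomalous good ordinary `p ≥ 3` with `E(ℚ_p)[p] = 0` DISCHARGED** (§1: `p ∤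
a_p − 1`). [cite: CastellaGrossiLeeSkinner2022, Thm. 5.1.1] [cite: SilvermanAEC2009, VII.3 Prop. 3.1] -/
theorem controlOnTreeGoodAt_of_thm511_of_not_dvd (h511 : thm511_anticyclotomicControl) (hp : 2 < p)
    (hord : GoodOrd W p) (hna : ¬ (p : ℤ) ∣ W.frobeniusTrace p - 1)
    (hK : IsImaginaryQuadratic K) (hHp : SatisfiesHeegnerHypothesis p K)
    {N : ℕ} (hN : W.conductorNorm ℤ = N) (hHN : SatisfiesHeegnerHypothesis N K)
    (ι : K →+* ℚ_[p]) (v vbar : HeightOneSpectrum (𝓞 K))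
    (hv : ∀ x : 𝓞 K, x ∈ v.asIdeal ↔ ‖ι (x : K)‖ < 1)
    (hvbar : ((p : ℕ) : 𝓞 K) ∈ vbar.asIdeal) (hne : vbar ≠ v)
    (κ : ZpExtension K p) (hκ : κ.IsAnticyclotomic)
    (γ : Field.absoluteGaloisGroup K) [Fact (κ.IsTopGenerator γ)]
    (hrk : (W.baseChange K).mordellWeilRank = 1)
    (hfin : Finite (AddCommGroup.primaryComponent (W.baseChange K).sha p))
    (P : (W.baseChange K).toAffine.Point) (hP : ¬ IsOfFinAddOrder P) :
    ControlOnTreeGoodAt p κ vbar γ ι P :=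
  controlOnTreeGoodAt_of_thm511 h511 hp hord hK hHp hN hHN ι v vbar hv hvbar hne κ hκ γ
    (LocalTorsion.localTorsion_eq_zero_of_good_of_not_dvd W p (by omega) hord.1 hna) hrk hfin P hP

end Control

/-! ### §3 STEP L at a classical Heegner datum: (CTL)ᵍ published, (IMC≥∘BDP)ᵍ typed -/

section Datum

variable (W : WeierstrassCurve ℚ) [W.IsElliptic] [W.IsGloballyMinimal] (p : ℕ) [Fact p.Prime]
  (N : ℕ) [NeZero N] (K : Type) [Field K] [NumberField K]
  (Dt : ModularParametrizationData W N) (H : HeegnerDatum N (NumberField.discr K)) (ιC : K →+* ℂ)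
  (P : (W.baseChange K).toAffine.Point)

/-- **STEP L `X11b.IndexLowerBoundAt W p K P_K` with the control link DISCHARGED by CGLS 2022
Thm. 5.1.1.** Data: `W/ℚ` globally minimal, `ord_{s=1} L(E,s) = 1`, `p > 2` good ordinary with
`a_p ≢ 1 (mod p)`, `K` imaginary quadratic with every `ℓ ∣ N = N_E` split and `p` split,
`L(E^{d_K},1) ≠ 0`, `P = P_K` the Heegner point of `(Dt, H, ιC)`; links at one datum `(κ, γ, v̄, ι)`
with `ι : K ↪ ℚ_p` inducing `v ≠ v̄`. Inputs: the TYPED (IMC≥∘BDP)ᵍ `hIW` and the PUBLISHED facts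
`h511` (CGLS Thm. 5.1.1), `hGZ` (Gross–Zagier), `hKo` (Kolyvagin), `hmod` (modularity: entire
`L`-function), `hGZK` (Gross–Zagier–Kolyvagin over `ℚ`). The hypotheses of Thm. 5.1.1 are
discharged: `E(ℚ_p)[p] = 0` (§1), `rank_ℤ E(K) = 1` and `#Ш(E/K)[p^∞] < ∞` (`hGZK` for `E` and
`E^{d_K}`, `mordellWeilRank_baseChange_eq_one_and_finite_sha_of_twist_L_one_ne_zero`), `P_K` of
infinite order (`not_isOfFinAddOrder_of_heegner_of_analyticRank_eq_one`). This is lit-glue's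
`indexLowerBoundAt_of_heegner_of_onTreeGoodLowerLinks_anyPrime` with `hCTL` no longer a binder.
[cite: CastellaGrossiLeeSkinner2022, Thm. 5.1.1] [cite: JetchevSkinnerWan2017, §7.4.1 (eq:shalowerK-1) (arXiv:1512.06894 p. 30)]
[cite: Kolyvagin1990, Thm. A] [cite: GrossLMS1991, Thm. 1.3] -/
theorem indexLowerBoundAt_of_heegner_of_thm511 (h511 : thm511_anticyclotomicControl)
    (hGZ : gross_zagier N W K) (hKo : kolyvagin N W K) (hmod : hasEntireLFunction_rat)
    (hGZK : rank_eq_analyticRank_of_analyticRank_le_one)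
    (hp : 2 < p) (hord : GoodOrd W p) (hna : ¬ (p : ℤ) ∣ W.frobeniusTrace p - 1)
    (hr : W.analyticRank = 1) (hN : W.conductorNorm ℤ = N) (hK : IsImaginaryQuadratic K)
    (hHN : SatisfiesHeegnerHypothesis N K) (hHp : SatisfiesHeegnerHypothesis p K)
    (hLt : (W.quadraticTwist (NumberField.discr K : ℚ)).entireLFunction 1 ≠ 0)
    (hP : WeierstrassCurve.Affine.Point.map ιC.toRatAlgHom P = heegnerPointComplex Dt H)
    {κ : ZpExtension K p} (hκ : κ.IsAnticyclotomic) {γ : Field.absoluteGaloisGroup K}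
    [Fact (κ.IsTopGenerator γ)] (ι : K →+* ℚ_[p]) (v vbar : HeightOneSpectrum (𝓞 K))
    (hv : ∀ x : 𝓞 K, x ∈ v.asIdeal ↔ ‖ι (x : K)‖ < 1)
    (hvbar : ((p : ℕ) : 𝓞 K) ∈ vbar.asIdeal) (hne : vbar ≠ v)
    (hIW : IMCLowerWaldspurgerOnTreeGoodAt p κ vbar γ ι P) :
    IndexLowerBoundAt W p K P := by
  -- rank and `Ш` over `ℚ` from GZK at `r_an = 1`, then over `K` by the descent lemma
  obtain ⟨hrQ, hShaQ⟩ := hGZK W hr.le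
  rw [hr] at hrQ
  obtain ⟨hrk, hfin⟩ :=
    mordellWeilRank_baseChange_eq_one_and_finite_sha_of_twist_L_one_ne_zero hGZK W K hK p hrQ hShaQ hLt
  -- the Heegner point is non-torsion
  have hPinf : ¬ IsOfFinAddOrder P :=
    not_isOfFinAddOrder_of_heegner_of_analyticRank_eq_one W N K Dt H ιC P hGZ hmod hr hK hHN hLt hP
  -- (CTL)ᵍ from the published theorem, then lit-glue's STEP-L theorem
  have hCTL : ControlOnTreeGoodAt p κ vbar γ ι P :=
    controlOnTreeGoodAt_of_thm511_of_not_dvd h511 hp hord hna hK hHp hN hHN ι v vbar hv hvbar hne κ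
      hκ γ hrk hfin P hPinf
  exact indexLowerBoundAt_of_heegner_of_onTreeGoodLowerLinks_anyPrime W p N K Dt H ιC P hGZ hKo hmod
    hr hN hK hHN hLt hP hIW hCTL

/-- **Row C6 spelling** (good Eisenstein non-anomalous `p > 2`: `Good`, `Red`, `¬ Anom`, ordinary
being automatic — `goodOrd_of_red_of_good`): STEP L at the Heegner datum from (IMC≥∘BDP)ᵍ typed +
CGLS Thm. 5.1.1 published + GZ/Kolyvagin/GZK/modularity. Compare `RowC6.indexLowerBoundAt_of_display55`
(STEP L from the DISPLAY (5.5) = A157): here the control half of (5.5)'s derivation is the numbered,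
published Thm. 5.1.1; the main-conjecture half (Thm. 4.2.2 ∘ Thm. 5.1.3) remains the typed `hIW`.
[cite: CastellaGrossiLeeSkinner2022, Thm. 5.1.1 and proof of Thm. 5.3.1 ((5.4)–(5.5))] -/
theorem RowC6.indexLowerBoundAt_of_heegner_of_thm511 (h511 : thm511_anticyclotomicControl)
    (hGZ : gross_zagier N W K) (hKo : kolyvagin N W K) (hmod : hasEntireLFunction_rat)
    (hGZK : rank_eq_analyticRank_of_analyticRank_le_one)
    (hp : 2 < p) (hgood : Good W p) (hred : Red W p) (hna : ¬ Anom W p)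
    (hr : W.analyticRank = 1) (hN : W.conductorNorm ℤ = N) (hK : IsImaginaryQuadratic K)
    (hHN : SatisfiesHeegnerHypothesis N K) (hHp : SatisfiesHeegnerHypothesis p K)
    (hLt : (W.quadraticTwist (NumberField.discr K : ℚ)).entireLFunction 1 ≠ 0)
    (hP : WeierstrassCurve.Affine.Point.map ιC.toRatAlgHom P = heegnerPointComplex Dt H)
    {κ : ZpExtension K p} (hκ : κ.IsAnticyclotomic) {γ : Field.absoluteGaloisGroup K}
    [Fact (κ.IsTopGenerator γ)] (ι : K →+* ℚ_[p]) (v vbar : HeightOneSpectrum (𝓞 K))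
    (hv : ∀ x : 𝓞 K, x ∈ v.asIdeal ↔ ‖ι (x : K)‖ < 1)
    (hvbar : ((p : ℕ) : 𝓞 K) ∈ vbar.asIdeal) (hne : vbar ≠ v)
    (hIW : IMCLowerWaldspurgerOnTreeGoodAt p κ vbar γ ι P) :
    IndexLowerBoundAt W p K P :=
  -- (qualified name: inside this declaration the short name would denote the declaration itself)
  X11b.indexLowerBoundAt_of_heegner_of_thm511 W p N K Dt H ιC P h511 hGZ hKo hmod hGZK hp
    (goodOrd_of_red_of_good W p hp hgood hred) (fun h ↦ hna ⟨hred, hgood, h⟩) hr hN hK hHN hHp hLt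
    hP hκ ι v vbar hv hvbar hne hIW

end Datum

end Summit.BirchSwinnertonDyer.Rank1Residual.X11b

end
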